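/-
Origin: expansion seat `planner-pub-hodgecm-mc-glue-1-g4-0`, handover #286 2026-08-19T01:07Z md5 44a5c912fb5612fdddd091f764dfa63d SUPERSEDES afe8d9be670f (t33-mcglue1g3.txt #286; 86 l.; rev 2 = rev 1 with `instance isOpenPosMeasure_pullbackν` RENAMED `instIsOpenPosMeasurePullbackν` to remove the FQ-name clash with PKG `HodgeCM/Model/Junction/PieceUnfolding.lean:140` `theorem QuotientModel.isOpenPosMeasure_pullbackν` (RUN 32) that breaks the aggregate `HodgeCM.lean`; (`HOME/mc/pub-hodgecm-mc-glue-1-g4/lean/QuotientModelOpenPos.lean`, md5 44a5c912, 86 lines);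
landed by the gen-9 packager (p-g9) in gate run 33 as `HodgeCM/Model/Junction/QuotientModelOpenPos.lean` (verbatim).
-/
/-
Copyright (c) 2026. All rights reserved.
Released under Apache 2.0 license as described in the file LICENSE.
-/
import Summits.HodgeConjecture.HodgeCM.Model.Junction.QuotientModelTransport

/-!
# J2′ — the folded measure of a quotient model is positive on open sets

For a quotient model `Q : QuotientModel` (Haar data `(Q.μ, Q.𝓕)`, `Q.isFundamentalDomain :
IsFundamentalDomain Q.Γ.op Q.𝓕 Q.μ`), the folded measure `Q.ν = π_*(Q.μ|𝓕)` on `Q.G ⧸ Q.Γ` is positive on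
non-empty open sets (`isOpenPosMeasure_ν`): for `U` open non-empty, `π⁻¹ U` is open, non-empty and
`Q.Γ.op`-invariant, so `Q.ν U = Q.μ (π⁻¹ U ∩ 𝓕) = 0` would force `Q.μ (π⁻¹ U) = 0`
(`IsFundamentalDomain.measure_zero_of_invariant`), contradicting positivity of Haar measure on opens.
The property passes to the pulled-back folded measure `Q.pullbackν Γ₁ e hΓ` along a topological-group
isomorphism (instance `instIsOpenPosMeasurePullbackν`, by the twin `isOpenPosMeasure_cosetPullback`; named apart from
the hypothesis-carrying theorem `QuotientModel.isOpenPosMeasure_pullbackν` of `Junction/PieceUnfolding.lean`, which the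
aggregate `HodgeCM.lean` imports alongside this file — rev 2, glue-1-g4) and to its REGIME
specialisation `V.regimeν hP h` on `U(V)(𝔸) ⧸ U(V)(L)` (`HermSpace3.isOpenPosMeasure_regimeν`) — the instance
binder `[μ.IsOpenPosMeasure]` of the tree junction (T2) `UnitaryBallAdelicLiftPetersson` at node E's measure.

Registry: pub-hodgecm MODEL-CONSTRUCTION sub-cell, node E (C2 junction). Everything here is `[folklore]`
measure theory; 0 named facts, 0 hypotheses, 0 records.
-/

noncomputable section

open MeasureTheory Literature.MeasureTheory.Group
open scoped Pointwise

namespace HodgeCM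

namespace QuotientModel

open HodgeCM.PerL34 HodgeCM.PerL34.QuotientSmoothing

variable (Q : QuotientModel)

/-- `π⁻¹ U ⊆ Q.G` is invariant under the right action of `Q.Γ` (i.e. under `Q.Γ.op`). [folklore] -/
theorem smul_preimage_mk_eq (γ : Q.Γ.op) (U : Set (Q.G ⧸ Q.Γ)) :
    γ • (QuotientGroup.mk ⁻¹' U : Set Q.G) = QuotientGroup.mk ⁻¹' U := by
  ext g
  rw [Set.mem_smul_set_iff_inv_smul_mem, Set.mem_preimage, Set.mem_preimage, Subgroup.smul_def,
    MulOpposite.smul_eq_mul_unop, QuotientGroup.mk_mul_of_mem]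
  exact Subgroup.mem_op.1 (γ⁻¹).2

/-- **The folded Haar measure `Q.ν = π_*(Q.μ|𝓕)` is positive on non-empty open sets.** [folklore] -/
instance isOpenPosMeasure_ν : Q.ν.IsOpenPosMeasure := by
  refine ⟨fun U hU hne => ?_⟩
  have hπ : Measurable (QuotientGroup.mk : Q.G → Q.G ⧸ Q.Γ) := QuotientGroup.continuous_mk.measurable
  have hU' : IsOpen (QuotientGroup.mk ⁻¹' U : Set Q.G) := hU.preimage QuotientGroup.continuous_mk
  rw [QuotientModel.ν, Measure.map_apply hπ hU.measurableSet, Measure.restrict_apply (hπ hU.measurableSet)]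
  intro h0
  exact (hU'.measure_pos Q.μ (hne.preimage QuotientGroup.mk_surjective)).ne'
    (Q.isFundamentalDomain.measure_zero_of_invariant _ (fun γ => Q.smul_preimage_mk_eq γ U) h0)

variable {G₁ : Type*} [Group G₁] [TopologicalSpace G₁]
  (Γ₁ : Subgroup G₁) [MeasurableSpace (G₁ ⧸ Γ₁)] [BorelSpace (G₁ ⧸ Γ₁)]
  (e : G₁ ≃ₜ* Q.G) (hΓ : ∀ g, e g ∈ Q.Γ ↔ g ∈ Γ₁)

/-- **The pulled-back folded measure `Q.pullbackν Γ₁ e hΓ` is positive on non-empty open sets.** [folklore] -/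
instance instIsOpenPosMeasurePullbackν : (Q.pullbackν Γ₁ e hΓ).IsOpenPosMeasure :=
  isOpenPosMeasure_cosetPullback e.toMulEquiv Γ₁ Q.Γ hΓ e.continuous e.symm.continuous Q.ν

end QuotientModel

namespace HermSpace3

open HodgeCM.Adelic HodgeCM.PerL34 HodgeCM.PerL34.QuotientSmoothing

variable (hP : PrintFact_unitaryCompact) {L : CMField} {ι₁ : L →+* ℂ} (V : HermSpace3 L ι₁)
  (h : IsAnisotropic L V.Hm)

variable [MeasurableSpace (adelicUnitaryGroup L V.Hm ⧸ adelicUnitaryRat L V.Hm)]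
  [BorelSpace (adelicUnitaryGroup L V.Hm ⧸ adelicUnitaryRat L V.Hm)]

/-- **The regime measure `V.regimeν hP h` on `U(V)(𝔸) ⧸ U(V)(L)` is positive on non-empty open sets.**
[folklore] -/
instance isOpenPosMeasure_regimeν : (V.regimeν hP h).IsOpenPosMeasure := by
  unfold regimeν; infer_instance

end HermSpace3

end HodgeCM

end
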